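import Summits.RiemannHypothesis.RiemannHypothesis.Theorems.UniversalFactorLaguerreCriterion
import Mathlib.Analysis.SpecialFunctions.ImproperIntegrals
import Mathlib.Analysis.SpecialFunctions.Pow.Real
import Mathlib.Analysis.Complex.ExponentialBounds
import Mathlib.Analysis.Real.Pi.Bounds

/-!
# RiemannHypothesis / UniversalFactor — the tail `∫_U^∞ Φ` of the Pólya–de Bruijn kernel

Route `RiemannHypothesis/UniversalFactor`, computation crux `MediumKernelNoGo`
(stmt-RiemannHypothesis-2577), line *one-sided-average-sign-test*, stub `stub_phiIoiTail`.

The certified evaluation of `H_0(x) = ∫₀^∞ Φ(u) cos(xu) du` truncates the integral at `u = U`; this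
file bounds the discarded tail explicitly:

* `UniversalFactor.phiIoiTail_tsum_majorant_le` — `∑ M n ≤ 50` for the summable majorant
  `M n = 5π² (n+1)⁴ e^{π} e^{−π (n+1)²}` of `Literature.NumberTheory.LFunctions.abs_deBruijnPhi_le`
  (termwise `M n ≤ 5π² e^{(4 − 3π) n}`, geometric series, `π < 3.1416`, `e > 2.718`);
* `UniversalFactor.stub_phiIoiTail` — for `U ≥ 0`,
  `∫_U^∞ Φ ≤ 50 e^{9U − π e^{4U}} / (4π e^{4U} − 9)`, from `Φ(u) ≤ 50 e^{9u − π e^{4u}}` and the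
  tangent-line bound `e^{4u} ≥ e^{4U} (1 + 4(u − U))`, which makes the exponent decrease linearly with
  slope `−(4π e^{4U} − 9) < 0`.

References: B. Rodgers, T. Tao, *The de Bruijn–Newman constant is non-negative*, Forum Math. Pi 8
(2020), §1 (the kernel `Φ` and its decay); E. C. Titchmarsh, *The theory of the Riemann
zeta-function*, 2nd ed., §10.1.
-/

set_option linter.dupNamespace false

noncomputable section

namespace Summit.RiemannHypothesis.RiemannHypothesis.Theorems

open MeasureTheory Set Complex
open Literature.NumberTheory.LFunctions

/-- `e^{-5} ≤ 1/148` (from `e > 2.7182818283`). [folklore] -/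
theorem UniversalFactor.phiIoiTail_exp_neg_five_le : Real.exp (-5) ≤ 1 / 148 := by
  have h5 : (148 : ℝ) ≤ Real.exp 5 := by
    calc (148 : ℝ) ≤ 2.7182818283 ^ 5 := by norm_num
      _ ≤ Real.exp 1 ^ 5 := pow_le_pow_left₀ (by norm_num) Real.exp_one_gt_d9.le 5
      _ = Real.exp 5 := by rw [Real.exp_one_pow]; norm_num
  rw [Real.exp_neg, inv_eq_one_div]
  exact one_div_le_one_div_of_le (by norm_num) h5

/-- Termwise geometric bound for the majorant: `M n ≤ 5π² e^{(4 − 3π) n}`, from `(n+1) ≤ eⁿ` and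
`(n+1)² − 1 = n² + 2n ≥ 3n`. [folklore] -/
theorem UniversalFactor.phiIoiTail_majorant_le_geom (n : ℕ) :
    deBruijnPhiMajorant n ≤ 5 * Real.pi ^ 2 * Real.exp (4 - 3 * Real.pi) ^ n := by
  have hn0 : (0 : ℝ) ≤ n := Nat.cast_nonneg n
  have h1 : ((n : ℝ) + 1) ^ 4 ≤ Real.exp (4 * n) := by
    have h := Real.add_one_le_exp (n : ℝ)
    calc ((n : ℝ) + 1) ^ 4 ≤ Real.exp n ^ 4 := pow_le_pow_left₀ (by positivity) h 4
      _ = Real.exp (4 * n) := by rw [← Real.exp_nat_mul]; norm_num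
  have hn : (n : ℝ) ≤ (n : ℝ) ^ 2 := by
    rcases Nat.eq_zero_or_pos n with h | h
    · simp [h]
    · have : (1 : ℝ) ≤ n := by exact_mod_cast h
      nlinarith
  have h2 : Real.exp Real.pi * Real.exp (-(Real.pi * ((n : ℝ) + 1) ^ 2)) ≤
      Real.exp (-(3 * Real.pi * n)) := by
    rw [← Real.exp_add]
    apply Real.exp_monotone
    nlinarith [mul_le_mul_of_nonneg_left hn Real.pi_pos.le]
  calc deBruijnPhiMajorant n
      = 5 * Real.pi ^ 2 * (((n : ℝ) + 1) ^ 4 *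
          (Real.exp Real.pi * Real.exp (-(Real.pi * ((n : ℝ) + 1) ^ 2)))) := by
        unfold deBruijnPhiMajorant; ring
    _ ≤ 5 * Real.pi ^ 2 * (Real.exp (4 * n) * Real.exp (-(3 * Real.pi * n))) := by gcongr
    _ = 5 * Real.pi ^ 2 * Real.exp (4 - 3 * Real.pi) ^ n := by
        rw [← Real.exp_nat_mul, ← Real.exp_add]; ring_nf

/-- The majorant sums to at most `50`: `∑ M n ≤ 5π² / (1 − e^{4 − 3π}) ≤ 50`. [folklore] -/
theorem UniversalFactor.phiIoiTail_tsum_majorant_le : ∑' n, deBruijnPhiMajorant n ≤ 50 := by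
  set r : ℝ := Real.exp (4 - 3 * Real.pi) with hr
  have hr0 : 0 ≤ r := (Real.exp_pos _).le
  have hr148 : r ≤ 1 / 148 := by
    refine le_trans ?_ UniversalFactor.phiIoiTail_exp_neg_five_le
    exact Real.exp_monotone (by linarith [Real.pi_gt_three])
  have hr1 : r < 1 := by linarith
  have hgeo : Summable fun n : ℕ ↦ 5 * Real.pi ^ 2 * r ^ n :=
    (summable_geometric_of_lt_one hr0 hr1).mul_left _
  calc ∑' n, deBruijnPhiMajorant n ≤ ∑' n : ℕ, 5 * Real.pi ^ 2 * r ^ n :=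
        summable_deBruijnPhiMajorant.tsum_le_tsum UniversalFactor.phiIoiTail_majorant_le_geom hgeo
    _ = 5 * Real.pi ^ 2 * (1 - r)⁻¹ := by rw [tsum_mul_left, tsum_geometric_of_lt_one hr0 hr1]
    _ ≤ 50 := by
        rw [← div_eq_mul_inv, div_le_iff₀ (by linarith)]
        nlinarith [Real.pi_lt_d4, Real.pi_pos]

/-- Pointwise decay past `U ≥ 0`: for `u ≥ U`,
`Φ(u) ≤ 50 e^{9U − π e^{4U}} e^{kU} e^{−ku}` with `k = 4π e^{4U} − 9`, i.e. the exponent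
`9u − π e^{4u}` lies below its tangent-type line of slope `−k` at `U`. [folklore] -/
theorem UniversalFactor.phiIoiTail_pointwise {U u : ℝ} (hU : 0 ≤ U) (hUu : U ≤ u) :
    deBruijnPhi u ≤ 50 * Real.exp (9 * U - Real.pi * Real.exp (4 * U)) *
      Real.exp ((4 * Real.pi * Real.exp (4 * U) - 9) * U) *
      Real.exp (-(4 * Real.pi * Real.exp (4 * U) - 9) * u) := by
  have hu0 : 0 ≤ u := hU.trans hUu
  set E : ℝ := Real.exp (4 * U) with hE
  have hE0 : 0 ≤ E := (Real.exp_pos _).le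
  have h1 : deBruijnPhi u ≤ 50 * Real.exp (9 * u - Real.pi * Real.exp (4 * u)) := by
    have h := abs_deBruijnPhi_le hu0
    rw [abs_of_pos (deBruijnPhi_pos_of_nonneg hu0)] at h
    refine h.trans ?_
    gcongr
    exact UniversalFactor.phiIoiTail_tsum_majorant_le
  have hexp : E * (4 * (u - U) + 1) ≤ Real.exp (4 * u) := by
    have h := Real.add_one_le_exp (4 * (u - U))
    have heq : Real.exp (4 * u) = E * Real.exp (4 * (u - U)) := by
      rw [hE, ← Real.exp_add]; ring_nf
    rw [heq]
    gcongr
  have h2 : 9 * u - Real.pi * Real.exp (4 * u) ≤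
      (9 * U - Real.pi * E) + (4 * Real.pi * E - 9) * U + (-(4 * Real.pi * E - 9) * u) := by
    nlinarith [Real.pi_pos, hexp, mul_le_mul_of_nonneg_left hexp Real.pi_pos.le]
  calc deBruijnPhi u ≤ 50 * Real.exp (9 * u - Real.pi * Real.exp (4 * u)) := h1
    _ ≤ 50 * Real.exp ((9 * U - Real.pi * E) + (4 * Real.pi * E - 9) * U +
          (-(4 * Real.pi * E - 9) * u)) := by gcongr
    _ = 50 * Real.exp (9 * U - Real.pi * E) * Real.exp ((4 * Real.pi * E - 9) * U) *
          Real.exp (-(4 * Real.pi * E - 9) * u) := by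
        rw [Real.exp_add, Real.exp_add]; ring

/-- **Stub `stub_phiIoiTail`** (line *one-sided-average-sign-test* of `MediumKernelNoGo`): the tail of
the Pólya–de Bruijn kernel past `U ≥ 0` satisfies
`∫_U^∞ Φ(u) du ≤ 50 e^{9U − π e^{4U}} / (4π e^{4U} − 9)`. Proof: `Φ(u) ≤ (∑ M n) e^{9u − π e^{4u}}`
with `∑ M n ≤ 50`, the exponent is bounded by `9U − π e^{4U} − k (u − U)` with
`k = 4π e^{4U} − 9 > 0` (tangent bound `e^{4u} ≥ e^{4U}(1 + 4(u − U))`), and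
`∫_U^∞ e^{−k(u − U)} du = 1/k`. [folklore] -/
theorem UniversalFactor.stub_phiIoiTail :
    ∀ U : ℝ, 0 ≤ U →
    ∫ u in Ioi U, deBruijnPhi u ≤
      50 * Real.exp (9 * U - Real.pi * Real.exp (4 * U)) / (4 * Real.pi * Real.exp (4 * U) - 9) := by
  intro U hU
  have hpt : ∀ u ∈ Ioi U, deBruijnPhi u ≤ 50 * Real.exp (9 * U - Real.pi * Real.exp (4 * U)) *
      Real.exp ((4 * Real.pi * Real.exp (4 * U) - 9) * U) *
      Real.exp (-(4 * Real.pi * Real.exp (4 * U) - 9) * u) :=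
    fun u hu ↦ UniversalFactor.phiIoiTail_pointwise hU (le_of_lt hu)
  set E : ℝ := Real.exp (4 * U) with hE
  set k : ℝ := 4 * Real.pi * E - 9 with hk
  set C : ℝ := 50 * Real.exp (9 * U - Real.pi * E) with hC
  have hE1 : 1 ≤ E := Real.one_le_exp (by linarith)
  have hkpos : 0 < k := by nlinarith [Real.pi_gt_three]
  have hint1 : IntegrableOn deBruijnPhi (Ioi U) :=
    UniversalFactor.integrableOn_deBruijnPhi.mono_set (Ioi_subset_Ioi hU)
  have hint2 : IntegrableOn (fun u : ℝ ↦ C * Real.exp (k * U) * Real.exp (-k * u)) (Ioi U) :=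
    (integrableOn_exp_mul_Ioi (by linarith : -k < 0) U).const_mul _
  have hee : Real.exp (k * U) * Real.exp (-k * U) = 1 := by
    rw [← Real.exp_add, neg_mul, add_neg_cancel, Real.exp_zero]
  calc ∫ u in Ioi U, deBruijnPhi u ≤ ∫ u in Ioi U, C * Real.exp (k * U) * Real.exp (-k * u) :=
        setIntegral_mono_on hint1 hint2 measurableSet_Ioi hpt
    _ = C * Real.exp (k * U) * (-Real.exp (-k * U) / (-k)) := by
        rw [integral_const_mul, integral_exp_mul_Ioi (by linarith) U]
    _ = C * (Real.exp (k * U) * Real.exp (-k * U)) / k := by rw [neg_div_neg_eq]; ring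
    _ = C / k := by rw [hee, mul_one]

end Summit.RiemannHypothesis.RiemannHypothesis.Theorems

end
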